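import Literature.AnabelianGeometry.EtaleTheta.XuuCocycle
import HarnessLib

/-!
# [EtTh] Prop. 2.2 (ii) / Def. 2.5 (i) / Def. 2.7 in the §1 model: the choice `X̲̲` constructed (part 2)

Mochizuki, *The étale theta function and its Frobenioid-theoretic manifestations*, Publ. RIMS **45**
(2009), §2, Def. 2.7 (PRIMS PDF p. 41): "it is a tautology that, upon restriction to the covering
`Ÿ̲̲ → Ÿ` … the class `η̈^Θ` determines a class `η̲̈^Θ ∈ H¹(Π^tp_Ÿ̲̲, l·Δ_Θ)`"; Prop. 2.2 (ii)/(iii)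
(p. 37); Def. 2.5 (i) (p. 39) [cite: MochizukiEtTh2009, Def 2.7 p.41].

Cell abc-iut, layer L2, item N3 (existence of the choice `X̲̲`; seat abc-iut-L2-t7), stage 2 part 2
(part 1: `XuuCocycle.lean` — the cocycle data `XuuCocycleData`, the zero set `Huu0 ⊆ Π^tp_X̲`,
cosets ↔ values, absorption). Here `Π^tp_X̲̲ := Huu0 ⊆ Π^tp_X` (`Huu`) and ALL fields of seat
abc-iut-L2-t8's `EtaleThetaData.DoubleUnderline` are PROVED for it: `Π^tp_X̲̲` is open (`isOpen_Huu`),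
`Π^tp_Ÿ ∩ Π^tp_X̲̲ ↠ G_K` (`map_aug_Ydduu`), `toZ(Π^tp_X̲̲) = l·Z` (`map_toZ_Huu`),
`[Π^tp_Y : Π^tp_Y ∩ Π^tp_X̲̲] = l` (`relIndex_Huu_GtpY`: cosets of the zero set in `Π^tp_Y` ↔
`Δ_Θ/l·Δ_Θ` bijectively), `θ(Π^tp_X̲̲) ∩ Δ_Θ = l·Δ_Θ` (`map_toTheta_Huu`), and `η̈^Θ|_{Π^tp_Ÿ̲̲}` is
`l·Δ_Θ`-valued BY CONSTRUCTION (`eta_res`); assembled as `XuuCocycleData.doubleUnderline :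
E.DoubleUnderline l`. So t8's INPUT N3 ("the choice of `X̲̲`") is reduced to the cocycle data of part 1
(the extension of `η̈^Θ mod l` to `Π^tp_X̲`, its normalisation over `Δ_Θ`, `[Δ_Θ : l·Δ_Θ] = l`).
Nothing here asserts that such data exist; typed ≠ endorsed; no side is taken on any disputed claim.
-/

noncomputable section

namespace Literature.AnabelianGeometry.EtaleTheta

open Literature.AnabelianGeometry.SemiGraphs

namespace ThetaSetting

namespace EtaleThetaData

namespace XuuCocycleData

variable {p : ℕ} [Fact p.Prime] {D : ThetaSetting p} {E : D.EtaleThetaData} {l : ℕ}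
  (Ξ : XuuCocycleData E l)

/-! ### `Π^tp_X̲̲` as a subgroup of `Π^tp_X` and the printed properties -/

/-- **`Π^tp_X̲̲ ⊆ Π^tp_X`**, the chosen covering `X̲̲ → X̲ → X`. [cite: MochizukiEtTh2009, Def 2.7 p.41] -/
def Huu : Subgroup D.PiTemp := Ξ.Huu0.map (D.GtpXu l).subtype

/-- `Π^tp_X̲̲ ⊆ Π^tp_X̲`. [cite: MochizukiEtTh2009, Def 2.5 (i) p.39] -/
theorem Huu_le_GtpXu : Ξ.Huu ≤ D.GtpXu l := by
  rintro _ ⟨g, -, rfl⟩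
  exact g.2

/-- Membership in `Π^tp_X̲̲` for an element of `Π^tp_X̲`. [cite: MochizukiEtTh2009, Def 2.7 p.41] -/
theorem mem_Huu_iff {g : D.PiTemp} (hg : g ∈ D.GtpXu l) :
    g ∈ Ξ.Huu ↔ (⟨g, hg⟩ : ↥(D.GtpXu l)) ∈ Ξ.Huu0 := by
  constructor
  · rintro ⟨x, hx, hxg⟩
    have : x = ⟨g, hg⟩ := Subtype.ext hxg
    rw [← this]; exact hx
  · intro h
    exact ⟨_, h, rfl⟩

/-- **`Π^tp_X̲̲` is open** (`X̲̲ → X` finite étale). [cite: MochizukiEtTh2009, Def 2.5 (i) p.39] -/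
theorem isOpen_Huu : IsOpen (Ξ.Huu : Set D.PiTemp) := by
  have h : (Ξ.Huu : Set D.PiTemp) = Subtype.val '' (Ξ.Huu0 : Set ↥(D.GtpXu l)) := by
    ext g; simp [Huu, Subgroup.coe_map]
  rw [h]
  exact (D.isOpen_GtpXu l).isOpenEmbedding_subtypeVal.isOpenMap _ Ξ.isOpen_Huu0

/-- **Absorption in `Π^tp_X`**: every `g ∈ Π^tp_X̲` is `g = h δ⁻¹` with `h ∈ Π^tp_X̲̲`, `δ ∈ Δ^tp_Ÿ`.
[cite: MochizukiEtTh2009, Def 2.7 p.41] -/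
theorem exists_mul_mem_Huu {g : D.PiTemp} (hg : g ∈ D.GtpXu l) :
    ∃ δ : D.PiTemp, δ ∈ D.DeltaTemp ∧ δ ∈ D.GtpYdd ∧ g * δ ∈ Ξ.Huu := by
  obtain ⟨δ, hΔ, hY, hmem⟩ := Ξ.exists_mul_mem_Huu0 ⟨g, hg⟩
  exact ⟨δ, hΔ, hY, ⟨_, hmem, rfl⟩⟩

/-- **`toZ(Π^tp_X̲̲) = l·Z`** (Def. 2.5 (i)(a); `Gal(Y̲̲/X̲̲) ≅ l·ℤ`). [cite: MochizukiEtTh2009, Def 2.5 (i) p.39] -/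
theorem map_toZ_Huu : Ξ.Huu.map D.toZ = Subgroup.zpowers (Multiplicative.ofAdd (l : ℤ)) := by
  refine le_antisymm ?_ ?_
  · exact (Subgroup.map_mono Ξ.Huu_le_GtpXu).trans (D.map_toZ_GtpXu l).le
  · intro z hz
    have hz' : z ∈ (D.GtpXu l).map D.toZ := by rw [D.map_toZ_GtpXu l]; exact hz
    obtain ⟨g, hg, rfl⟩ := hz'
    obtain ⟨δ, -, hY, hmem⟩ := Ξ.exists_mul_mem_Huu hg
    refine ⟨g * δ, hmem, ?_⟩
    have hδ : D.toZ δ = 1 := D.GtpYdd_le_GtpY hY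
    rw [map_mul, hδ, mul_one]

/-- **`Π^tp_Ÿ̲̲ = Π^tp_Ÿ ∩ Π^tp_X̲̲` maps onto `G_K`** (`Ÿ̲̲` geometrically connected over `K = K̈`).
[cite: MochizukiEtTh2009, Prop 2.2 (iii) p.37] -/
theorem map_aug_Ydduu : (D.GtpYdd ⊓ Ξ.Huu).map D.aug.toMonoidHom = D.GK := by
  refine le_antisymm ?_ ?_
  · rintro _ ⟨x, -, rfl⟩
    exact D.aug_mem_GK x
  · intro γ hγ
    rw [← map_aug_GtpYdd Ξ.sec2] at hγ
    obtain ⟨g, hg, rfl⟩ := hγ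
    obtain ⟨δ, hΔ, hY, hmem⟩ := Ξ.exists_mul_mem_Huu (GtpYdd_le_GtpXu l hg)
    refine ⟨g * δ, ⟨mul_mem hg hY, hmem⟩, ?_⟩
    have hδ : D.aug.toMonoidHom δ = 1 := hΔ
    rw [map_mul, hδ, mul_one]

/-- **`[Π^tp_Y : Π^tp_Y̲̲] = l`** ("`Y̲̲ → Y` of degree `l`", p. 41): the cosets of `Π^tp_Y ∩ Π^tp_X̲̲` in
`Π^tp_Y` correspond bijectively to `Δ_Θ/l·Δ_Θ` via `F̄`. [cite: MochizukiEtTh2009, Def 2.7 p.41] -/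
theorem relIndex_Huu_GtpY : (Ξ.Huu ⊓ D.GtpY).relIndex D.GtpY = l := by
  classical
  rw [Subgroup.inf_relIndex_right, Subgroup.relIndex]
  suffices h : (Ξ.Huu.subgroupOf D.GtpY).index = (Lsub D l).index by
    rw [h]; exact Ξ.index_lDeltaTheta
  -- the element of `Π^tp_X̲` under `y ∈ Π^tp_Y`
  let ι : ↥D.GtpY → ↥(D.GtpXu l) := fun y => ⟨y.1, D.GtpY_le_GtpXu l y.2⟩
  have hι : ∀ y y' : ↥D.GtpY, (ι y)⁻¹ * ι y' = ι (y⁻¹ * y') := fun _ _ => rfl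
  have key : ∀ y y' : ↥D.GtpY,
      y⁻¹ * y' ∈ Ξ.Huu.subgroupOf D.GtpY ↔ Ξ.Fbar (ι y) = Ξ.Fbar (ι y') := by
    intro y y'
    rw [Subgroup.mem_subgroupOf, ← inv_mul_mem_Huu0_iff, hι,
      Ξ.mem_Huu_iff (D.GtpY_le_GtpXu l (y⁻¹ * y').2)]
  let Ψ : ↥D.GtpY ⧸ Ξ.Huu.subgroupOf D.GtpY → DeltaThetaModL D l :=
    Quotient.lift (fun y => Ξ.Fbar (ι y)) fun y y' h => by
      rw [← key, ← QuotientGroup.leftRel_apply]; exact h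
  refine Nat.card_eq_of_bijective Ψ ⟨?_, ?_⟩
  · intro a b
    induction a using Quotient.inductionOn with | h y => ?_
    induction b using Quotient.inductionOn with | h y' => ?_
    intro hab
    exact Quotient.sound (QuotientGroup.leftRel_apply.mpr ((key y y').mpr hab))
  · intro u
    induction u using QuotientGroup.induction_on with | H t => ?_
    obtain ⟨δ, -, hY, hF⟩ := Ξ.exists_Fbar_eq t
    exact ⟨Quotient.mk _ ⟨(δ : D.PiTemp), D.GtpYdd_le_GtpY hY⟩, hF⟩

/-- An element of `Π^tp_X̲̲` whose image lies in `Δ_Θ` is geometric. [cite: MochizukiEtTh2009, Def 2.7 p.41] -/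
theorem mem_deltaTemp_of_toTheta_mem (Ξ : XuuCocycleData E l) {g : D.PiTemp}
    (hg : D.toTheta g ∈ D.DeltaTheta) : g ∈ D.DeltaTemp := by
  obtain ⟨δ, hΔ, -, hδt⟩ := Ξ.exists_toTheta_eq ⟨D.toTheta g, hg⟩
  have hk : g * (δ : D.PiTemp)⁻¹ ∈ D.toTheta.ker := by
    rw [MonoidHom.mem_ker, map_mul, map_inv, hδt, mul_inv_cancel]
  have := mul_mem (D.ker_toTheta_le_deltaTemp hk) hΔ
  simpa using this

/-- **`θ(Π^tp_X̲̲) ∩ Δ_Θ = l·Δ_Θ`** ("`Δ_X̲̲ = Im(s_ι)`" meets `Δ_Θ` in `Ker(Δ̄^Θ ↠ Δ̄^ell) = l·Δ_Θ`,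
Prop. 2.2 (ii), Prop. 2.12 (i)). [cite: MochizukiEtTh2009, Prop 2.2 (ii) p.37] -/
theorem map_toTheta_Huu : Ξ.Huu.map D.toTheta ⊓ D.DeltaTheta = D.lDeltaTheta l := by
  refine le_antisymm ?_ ?_
  · rintro t ⟨⟨g, hg, rfl⟩, ht⟩
    have hgX : g ∈ D.GtpXu l := Ξ.Huu_le_GtpXu hg
    have hΔ : g ∈ D.DeltaTemp := Ξ.mem_deltaTemp_of_toTheta_mem ht
    have h0 : (⟨g, hgX⟩ : ↥(D.GtpXu l)) ∈ Ξ.Huu0 := (Ξ.mem_Huu_iff hgX).1 hg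
    have hF : ((Ξ.F ⟨g, hgX⟩ : D.DeltaTheta) : D.GtpTheta) ∈ D.lDeltaTheta l :=
      (Ξ.mem_Huu0_iff _).1 h0
    have h1 := Ξ.F_theta ⟨g, hgX⟩ hΔ ht
    -- `F(g) ∈ l·Δ_Θ` and `F(g)⁻¹ θ(g)^e ∈ l·Δ_Θ`, so `θ(g)^e ∈ l·Δ_Θ`, so `θ(g) ∈ l·Δ_Θ`
    have hF' : Ξ.F ⟨g, hgX⟩ ∈ Lsub D l := by rw [Subgroup.mem_subgroupOf]; exact hF
    have h2 : (⟨D.toTheta g, ht⟩ : D.DeltaTheta) ^ Ξ.e ∈ Lsub D l := by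
      have := mul_mem hF' h1
      simpa using this
    have h3 := Ξ.mem_of_pow_mem _ h2
    rw [Subgroup.mem_subgroupOf] at h3
    exact h3
  · intro t ht
    have htΔ : t ∈ D.DeltaTheta := D.lDeltaTheta_le l ht
    obtain ⟨δ, hΔ, -, hδt⟩ := Ξ.exists_toTheta_eq ⟨t, htΔ⟩
    have h0 : δ ∈ Ξ.Huu0 := by
      change Ξ.Fbar δ = 1
      rw [Ξ.Fbar_eq_of_toTheta_eq δ hΔ ⟨t, htΔ⟩ hδt, QuotientGroup.eq_one_iff]
      exact Subgroup.zpow_mem _ (by rw [Subgroup.mem_subgroupOf]; exact ht) _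
    exact ⟨⟨(δ : D.PiTemp), ⟨δ, h0, rfl⟩, hδt⟩, htΔ⟩

/-- **`η̈^Θ|_{Π^tp_Ÿ̲̲}` is `l·Δ_Θ`-valued** — BY CONSTRUCTION ("it is a tautology that … `η̈^Θ`
determines a class `η̲̈^Θ ∈ H¹(Π^tp_Ÿ̲̲, l·Δ_Θ)`", p. 41): the restriction of the representative `f`
to the zero set. [cite: MochizukiEtTh2009, Def 2.7 p.41] -/
theorem eta_res : ∃ (f : ↥(D.GtpYdd ⊓ Ξ.Huu) → D.DeltaTheta)
    (hf : f ∈ contCocycles D.toTheta D.DeltaTheta (D.GtpYdd ⊓ Ξ.Huu)),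
    (∀ g, (f g : D.GtpTheta) ∈ D.lDeltaTheta l) ∧
      ContH1.mk f hf = ContH1.res D.toTheta D.DeltaTheta inf_le_left E.etaDd := by
  refine ⟨(ContH1.resCocycle D.toTheta D.DeltaTheta
      (inf_le_left : D.GtpYdd ⊓ Ξ.Huu ≤ D.GtpYdd) Ξ.f).1,
    (ContH1.resCocycle D.toTheta D.DeltaTheta inf_le_left Ξ.f).2, fun g => ?_, ?_⟩
  · -- `f(g) ≡ F(g) ∈ l·Δ_Θ`
    have hgY : (g : D.PiTemp) ∈ D.GtpYdd := (Subgroup.mem_inf.1 g.2).1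
    have hgH : (g : D.PiTemp) ∈ Ξ.Huu := (Subgroup.mem_inf.1 g.2).2
    have hgX : (g : D.PiTemp) ∈ D.GtpXu l := GtpYdd_le_GtpXu l hgY
    have hF : ((Ξ.F ⟨g, hgX⟩ : D.DeltaTheta) : D.GtpTheta) ∈ D.lDeltaTheta l :=
      (Ξ.mem_Huu0_iff _).1 ((Ξ.mem_Huu_iff hgX).1 hgH)
    have h1 := Ξ.F_res ⟨g, hgY⟩
    rw [Subgroup.mem_subgroupOf, Subgroup.coe_mul, Subgroup.coe_inv] at h1
    have := mul_mem hF h1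
    simpa [ContH1.resCocycle] using this
  · rw [← Ξ.mk_f]
    rfl

/-- **The choice `X̲̲` constructed** (Prop. 2.2 (ii) / Def. 2.5 (i) / Def. 2.7 in the §1 model): the
zero set of the cocycle data is a `DoubleUnderline` in the sense of seat abc-iut-L2-t8 — all its
printed properties PROVED from `XuuCocycleData`. [cite: MochizukiEtTh2009, Def 2.7 p.41] -/
def doubleUnderline : E.DoubleUnderline l where
  l_odd := Ξ.l_odd
  Huu := Ξ.Huu
  isOpen_Huu := Ξ.isOpen_Huu
  map_aug_Ydduu := Ξ.map_aug_Ydduu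
  map_toZ_Huu := Ξ.map_toZ_Huu
  relIndex_Huu_GtpY := Ξ.relIndex_Huu_GtpY
  map_toTheta_Huu := Ξ.map_toTheta_Huu
  eta_res := Ξ.eta_res

end XuuCocycleData

end EtaleThetaData

end ThetaSetting

end Literature.AnabelianGeometry.EtaleTheta

end
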